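import Literature.AnabelianGeometry.SemiGraphs.CovObjPointPresentation
import Literature.AnabelianGeometry.SemiGraphs.TemperedCoveringsComponents
import Literature.AnabelianGeometry.SemiGraphs.Prop36HypothesesWitness

/-!
# [SemiAnbd] Def. 2.2 (i): NON-VACUITY of the point data `ProfiniteSemiGraph.CovObj.PtData` — the exact
# inhabitation condition, and witnesses (NV-L3 wave)

S. Mochizuki, *Semi-graphs of anabelioids*, Publ. RIMS **42** (2006) 221–322, Def. 2.2 (i) p. 23 /
Rmk. 2.2.1 p. 24 / §3 p. 41 (the point presentation of a Galois covering); typed by the cell's dictionary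
file `CovObjPointPresentation.lean` as `CovObj.PtData S`: a base point `x_w ∈ S_w` at EVERY vertex and,
for EVERY edge `e`, a reference branch `β e` of `e` abutting to a vertex `ν e`
[cite: MochizukiSemiAnbd2006, Def. 2.2(i) p.23].

abc-iut cell, layer L3, PROOF-ONLY non-vacuity file (seat abc-iut-w5-d149 gen 3; row family «NV-L3»,
abc-iut-w4-d098's INHABITATION-CENSUS-L3-v1 §A1: `ProfiniteSemiGraph.CovObj.PtData` has ZERO producers).
No `def`, no `instance`, no `structure`, no named fact.  Content:

* `CovObj.nonempty_ptData_iff` — the EXACT inhabitation condition: point data exist iff every vertex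
  fibre `S_w` is nonempty AND every edge has at least one branch abutting to a vertex (its verticial
  portion is nonempty — automatic for a GRAPH, false for an edge both of whose branches are "open");
* `CovObj.nonempty_ptData_of_isGraph` — hence, over a graph (every branch abuts, §1 p. 11), every
  covering object with nonempty vertex fibres (`HasNonemptyFibres`) carries point data: GENUINE
  (this is exactly the situation of Rmk. 2.2.1 / Thm. 3.7 (iii) where the presentation is used);
* `CovObj.nonempty_ptData_trivialCov` — in particular the trivial coverings of a graph of anabelioids
  (`CovObj.trivialCov`, Def. 3.5 (i)) carry point data; closed-form instance at the cell's one-vertex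
  edgeless witness `ProfiniteSemiGraph.affWitness p` (`Prop36HypothesesWitness.lean`; HONEST LABEL:
  the edge clause is vacuous there — it has no edges).

Nothing in this file takes a side on [IUTchIII] Cor. 3.12; a witness is consistency evidence for an
interface, not an endorsement; typed ≠ proved.
-/

namespace Literature.AnabelianGeometry.SemiGraphs

namespace ProfiniteSemiGraph

open CategoryTheory

universe u

variable {𝒢 : ProfiniteSemiGraph.{u}}

/-- **Exact inhabitation condition for the point data of Def. 2.2 (i)**: `S.PtData` is inhabited iff
every vertex fibre `S_w` is nonempty and every edge `e` possesses a branch abutting to some vertex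
(nonempty verticial portion). [cite: MochizukiSemiAnbd2006, Def. 2.2(i) p.23] -/
theorem CovObj.nonempty_ptData_iff (S : CovObj 𝒢) :
    Nonempty S.PtData ↔
      (∀ w : 𝒢.graph.Vertex, Nonempty (S.SV w).obj.V) ∧
        ∀ e : 𝒢.graph.Edge, ∃ b : 𝒢.graph.Branch, 𝒢.graph.edgeOf b = e ∧ (𝒢.graph.abuts b).isSome := by
  constructor
  · rintro ⟨D⟩
    refine ⟨fun w => ⟨D.x w⟩, fun e => ⟨D.β e, D.edgeOf_β e, ?_⟩⟩
    rw [D.abuts_β e]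
    rfl
  · rintro ⟨hV, hE⟩
    choose β hβe hβa using hE
    refine ⟨{ x := fun w => (hV w).some
              β := β
              edgeOf_β := hβe
              ν := fun e => (𝒢.graph.abuts (β e)).get (hβa e)
              abuts_β := fun e => ?_ }⟩
    exact (Option.some_get (hβa e)).symm

/-- Over a GRAPH (every branch abuts to a vertex, §1 p. 11) every edge has an abutting branch: the
edge clause of `nonempty_ptData_iff` is automatic. [cite: MochizukiSemiAnbd2006, §1 p.11] -/
theorem exists_branch_abuts_of_isGraph (hG : 𝒢.graph.IsGraph) (e : 𝒢.graph.Edge) :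
    ∃ b : 𝒢.graph.Branch, 𝒢.graph.edgeOf b = e ∧ (𝒢.graph.abuts b).isSome := by
  obtain ⟨b₁, _, _, hb₁, _, _⟩ := 𝒢.graph.two_branches e
  exact ⟨b₁, hb₁, hG.abuts_isSome b₁⟩

/-- **GENUINE**: over a graph of anabelioids, every covering object with nonempty fibres carries the
point data of Def. 2.2 (i) (base points at all vertices, reference abutting branches at all edges) —
the situation of Rmk. 2.2.1 p. 24 / the proof of Thm. 3.7 (iii) p. 41.
[cite: MochizukiSemiAnbd2006, Def. 2.2(i) p.23] -/
theorem CovObj.nonempty_ptData_of_isGraph (hG : 𝒢.graph.IsGraph) (S : CovObj 𝒢)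
    (hS : S.HasNonemptyFibres) : Nonempty S.PtData :=
  (CovObj.nonempty_ptData_iff S).mpr ⟨hS.nonempty_V, exists_branch_abuts_of_isGraph hG⟩

/-- Conversely the vertex-fibre condition is necessary: point data force nonempty vertex fibres.
[cite: MochizukiSemiAnbd2006, Def. 2.2(i) p.23] -/
theorem CovObj.nonempty_SV_of_ptData {S : CovObj 𝒢} (D : S.PtData) (w : 𝒢.graph.Vertex) :
    Nonempty (S.SV w).obj.V :=
  ⟨D.x w⟩

/-- The trivial covering with nonempty fibre type `X` (Def. 3.5 (i); `CovObj.trivialCov`) over a graph of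
anabelioids carries point data. GENUINE. [cite: MochizukiSemiAnbd2006, Def 3.5(i) p.37] -/
theorem CovObj.nonempty_ptData_trivialCov (hG : 𝒢.graph.IsGraph) (X : Type u) [Countable X]
    [Nonempty X] : Nonempty (CovObj.trivialCov 𝒢 X).PtData :=
  CovObj.nonempty_ptData_of_isGraph hG _
    ⟨fun _ => inferInstanceAs (Nonempty X), fun _ => inferInstanceAs (Nonempty X)⟩

/-- Closed-form instance at the cell's one-vertex, edgeless semi-graph of anabelioids
`affWitness p` (vertex group `Aff(ℤ_p)`, `Prop36HypothesesWitness.lean`): its one-sheeted trivial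
covering carries point data.  HONEST LABEL: the edge clause is vacuous (no edges).
[cite: MochizukiSemiAnbd2006, Def. 2.2(i) p.23] -/
theorem CovObj.nonempty_ptData_trivialCov_affWitness (p : ℕ) [Fact p.Prime] :
    Nonempty (CovObj.trivialCov (affWitness p) PUnit.{1}).PtData :=
  CovObj.nonempty_ptData_trivialCov ⟨fun b => (b : PEmpty).elim⟩ PUnit

end ProfiniteSemiGraph

end Literature.AnabelianGeometry.SemiGraphs
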